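/-
Origin: expansion seat `prover-pub-hodgecm-own-htheta-0`, handover #H8 2026-08-21T05:25Z md5 103d3c8ab4bf (333 l.; NEW additive KERNEL leaf beside E; imports binder-2 #105 `HodgeCM.Model.Binders.JLiuSlots01` (RUN 72) ONLY; ns HodgeCM.Model (§0) + HodgeCM.Model.ThetaAdelicSide; 3 theorems 0 defs: §0 `mem_block_pin_of_line_eq_of_mem_biSup` (binder-2 #104 in single-block form, via `LiuAlbaneseModuleDatum.biSup_iSup_range_le_block_of_surjective`) and SLOTS 0 ∕ 1 of the junction binder PIN-GENERICALLY with the conclusion «∃ j (the index of the χ_k-twisted slot record), line j ≅ ⟨a_k⟩ ∧ ∀ Γ ω, ∃ cf, res cf = ω ∧ ofLevel cf ∈ block j» — binder-2-g20's `hJ_slot_{zero,one}_of_lineRepOf` section variables, hypotheses and proof steps VERBATIM (they exhibit T := {j} and conclude `∈ ⨆ j' ∈ T, block j'`; here the singleton is exposed); ROWDEP #105 — DEFER if RUN 72 drops it; NAMES for audit: HodgeCM.Model.mem_block_pin_of_line_eq_of_mem_biSup · HodgeCM.Model.ThetaAdelicSide.hJ_slot_zero_block_of_lineRepOf · HodgeCM.Model.ThetaAdelicSide.hJ_slot_one_block_of_lineRepOf)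 (`HOME/pub-hodgecm-own-htheta/stage73/HodgeCM/Model/HThetaBlockSlots01.lean`, md5 103d3c8ab4bf, 333 lines);
landed by the gen-31 packager (p-g31) in gate run 73 as `HodgeCM/Model/HThetaBlockSlots01.lean` (verbatim).
-/
/-
Copyright (c) 2026 the pub-hodgecm formalisation cell (harness21).  New file, not vendored.
Origin: ROW-9 OWNER seat `prover-pub-hodgecm-own-htheta-0` (unit pub-hodgecm-own-htheta, named single owner of the (J-Liu-Θ) junction
theorem ∕ binder row 9 `hΘ`), 2026-08-21.  Target in PKG: `HodgeCM/Model/HThetaBlockSlots01.lean` (NEW additive KERNEL leaf beside E; imports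
binder-2 #105 `HodgeCM.Model.Binders.JLiuSlots01` (RUN 72); nothing imports it; outside E's import closure; E untouched; MODEL-N ±0).
KERNEL ONLY: theorems; 0 defs, 0 records, nothing cited, 0 `def … : Prop`.  The section variable blocks and the proof bodies are binder-2-g20's
`Binders/JLiuSlots01.lean` VERBATIM (their pin-generic data and steps); what changes is the SHAPE OF THE CONCLUSION: ONE index `j_k` with
the tower vector IN `block j_k` (binder-2 exhibit `T := {{j_k}}` and conclude `∈ ⨆ j' ∈ T, block j'`, hiding the singleton behind `∃ T`).
Nothing here is a claim of the manuscripts under adjudication.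
-/
import Summits.HodgeConjecture.HodgeCM.Model.Binders.JLiuSlots01

set_option autoImplicit false

/-!
# (J3) THE JUNCTION BINDER, SLOTS 0 AND 1, PIN-GENERICALLY — ONE INDEX, ONE BLOCK (for the `Thm418C`-only junction)

binder-2-g20's `hJ_slot_k_of_lineRepOf` (`Binders/JLiuSlots01`) prove, for E's theta model over any side family reading `lineRepOf …` at
slot `k`, that every theta class is `res cf` of a level-`Γ` tower vector `cf` with `ofLevel cf ∈ ⨆ j' ∈ T, block j'` for a finite set `T`
of indices isometric to the slot line — and their proof takes `T := {{j_k}}`, `j_k` THE index of the `χ_k`-twisted slot record (theta-3 #S19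
`LiuIndex.I.exists_line_eq_twistBy_bigCharOfV_of_eq`).  The statements below EXPOSE that: `∃ j, (line j ≅ ⟨a_k⟩) ∧ ∀ Γ ω, ∃ cf, res cf = ω ∧
ofLevel cf ∈ block j`.  With the tower vector in ONE block, the combined reading `Thm418C` (r8) applies to it DIRECTLY (it is stated on
`block μ ∩ H^K`), so the junction needs neither Prop. 4.13's decomposition nor `Irreducible ∕ Thm418_2 ∕ MuSeparated` (this seat's
`Model/HsmallOfBlockAt`).  Hypotheses, section variables and proof steps: binder-2's, verbatim; the last step uses the single-block form
`mem_block_pin_of_line_eq_of_mem_biSup` of binder-2 #104 (over `LiuAlbaneseModuleDatum.biSup_iSup_range_le_block_of_surjective`).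
`#print axioms` ⊆ {{propext, Classical.choice, Quot.sound}}.
-/

noncomputable section

open NumberField hiding relNormOneIdeles relNormOneRat probHaarRelNormOneQuot
open _root_.NumberField.InfinitePlace _root_.NumberField.mixedEmbedding MeasureTheory MulAction IsDedekindDomain
open scoped Matrix TensorProduct Classical SchwartzMap
open Literature.Geometry.ComplexHyperbolic.BallModel (U21 x₀ stabilizerEquivK21)
open Literature.NumberTheory.Automorphic.U21 (K21 matA sclD)
open Literature.NumberTheory.Automorphic Literature.NumberTheory.Automorphic.UnitaryGroup Literature.NumberTheory.Weil1964
open Literature.NumberTheory.GelbartRogawski1991 Literature.NumberTheory.GelbartRogawski1991.UnitaryDualPair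
open Literature.AlgebraicGeometry.HodgeTheory Literature.AlgebraicGeometry.ShimuraVarieties Literature.AlgebraicGeometry.ShimuraVarieties.BallForms
open Literature.NumberTheory.Automorphic.PicardCM
open Literature.NumberTheory.Transcendental (Arapura2012_Cor_15_4_6)
open Literature.Analysis.SegalBargmann
open HodgeCM.Adelic HodgeCM.PerL34 HodgeCM.Model.HypCensus HodgeCM.Model.ArchSideTerm HodgeCM.Model.ThetaDistFin HodgeCM.Model.TowerCarrier
open HodgeCM.Model.SupplyInstance HodgeCM.Model.SupplyResidual HodgeCM.Model.ThetaSpace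
open HodgeCM.Model.SupplyResidual.WeilPairData (charInv)

open HodgeCM.Model.TowerLevel HodgeCM.Model.TowerCarrier

namespace HodgeCM.Model

/-! ## §0 binder-2 #104 in single-block form -/

section BlockPin

variable (hHD : exists_isReal_hodgeModel) (hI : hodgePQ_independent_of_hodgeModel)
  (h₁ : BallQuotientUniformised) (h₃ : CMAbelianVarietyRealised) (hA : Arapura2012_Cor_15_4_6)
variable {L : CMField} {ι₁ : (L : Type) →+* ℂ} (V : HermSpace3 L ι₁) (I : Type) (line : I → SplitLineE V)
variable {X : Type*} {P : X → Prop} (M : X → Type*) [∀ y, AddCommGroup (M y)] [∀ y, Module (adelicAlgebra V) (M y)]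

/-- **the block clause at the pin, ONE block**: binder-2 #104 `mem_biSup_block_pin_of_line_eq_of_mem_biSup` with the conclusion
`∈ block j` (via `LiuAlbaneseModuleDatum.biSup_iSup_range_le_block_of_surjective`). [folklore] -/
theorem mem_block_pin_of_line_eq_of_mem_biSup {j : I} {p : SplitLineE V} (hp : line j = p)
    (ψ : X → p.CharW) (hψ : ∀ y, P y → p.IsAutChar (ψ y))
    (φ : ∀ (y) (_ : P y), p.Ω (ιVE V) (ψ y) →ₗ[adelicAlgebra V] M y) (hφ : ∀ y hy, Function.Surjective (φ y hy))
    {x : Tower hHD hI (ballQuotientUniformisedDatum_of h₁) h₃ hA V}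
    (hx : x ∈ ⨆ (y : X) (_ : P y), ⨆ f : M y →ₗ[adelicAlgebra V] Tower hHD hI (ballQuotientUniformisedDatum_of h₁) h₃ hA V,
      (LinearMap.range f).restrictScalars ℂ) :
    (x : (liuDictionaryPin hHD hI h₁ h₃ hA V I line).H) ∈ (liuDictionaryPin hHD hI h₁ h₃ hA V I line).block j := by
  subst hp
  exact (liuDictionaryPin hHD hI h₁ h₃ hA V I line).biSup_iSup_range_le_block_of_surjective M j
    (fun y hy => ⟨ψ y, hψ y hy⟩) φ hφ hx

end BlockPin

end HodgeCM.Model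

namespace HodgeCM.Model
namespace ThetaAdelicSide

variable (hHD : exists_isReal_hodgeModel) (hI : hodgePQ_independent_of_hodgeModel)
  (h₁ : BallQuotientUniformised) (h₃ : CMAbelianVarietyRealised) (hA : Arapura2012_Cor_15_4_6)
variable {L : CMField} {ι₁ : L →+* ℂ} (V : HermSpace3 L ι₁) (c : SeesawCtx L) (S : ThetaAdelicSide V c)
  (hGR : (cmSplittingDatum (L : Type) finProdFinEquiv (frameD V) (frameD_real V) (frameD_ne V) (dW c.D) (dW_real c.D)
    (dW_ne c.D)).CompatibleSplitting)
  (hGR₀ : (cmSplittingDatum (L : Type) (e₁) (frameD V) (frameD_real V) (frameD_ne V) (lineVec (L : Type) (dW c.D 0))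
    (fun _ => dW_real c.D 0) (fun _ => dW_ne c.D 0)).CompatibleSplitting)
  (hGR₁ : (cmSplittingDatum (L : Type) (e₁) (frameD V) (frameD_real V) (frameD_ne V) (lineVec (L : Type) (dW c.D 1))
    (fun _ => dW_real c.D 1) (fun _ => dW_ne c.D 1)).CompatibleSplitting)
  (hGR₂ : (cmSplittingDatum (L : Type) (e₁) (frameD V) (frameD_real V) (frameD_ne V) (lineVec (L : Type) (dW' c.D 0))
    (fun _ => dW'_real c.D 0) (fun _ => dW'_ne c.D 0)).CompatibleSplitting)
  (hGR₃ : (cmSplittingDatum (L : Type) (e₁) (frameD V) (frameD_real V) (frameD_ne V) (lineVec (L : Type) (dW' c.D 1))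
    (fun _ => dW'_real c.D 1) (fun _ => dW'_ne c.D 1)).CompatibleSplitting)
  (χ₀ χ₁ χ₂ χ₃ : CMAdelic (L : Type) (frameD V) × CMAdelicOne (L : Type) →* ℂˣ)
  (hι : S.ιinf = archInfOf V)
  (h₁W : (∀ j, 0 < (ι₁ (dW c.D j)).re) ∨ ∀ j, (ι₁ (dW c.D j)).re < 0)
  (hV : IsAnisotropic L V.Hm)
  (hemb : (InfinitePlace.mk ι₁).embedding = ι₁)

variable (μ : LiuIndex.GramClass L → InfinitePlace (L : Type) → ℤ)

/-! ## Slot 0 -/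

section Zero

variable (hP : (S.P 0).ω = lineRepOf V c.D hGR hGR₀ hGR₁ hGR₂ hGR₃ χ₀ χ₁ χ₂ χ₃ 0)
  (hχc : Continuous fun p => ((χ₀ p : ℂˣ) : ℂ))
  (eR : PosIdx (cmXW (L : Type) (frameD V) (lineVec (L : Type) (dW c.D 0)) (fun _ => dW_real c.D 0) ι₁ (HypCensus.cmPlace (L : Type) ι₁)) ≃ Unit)
  (eS : NegIdx (cmXW (L : Type) (frameD V) (lineVec (L : Type) (dW c.D 0)) (fun _ => dW_real c.D 0) ι₁ (HypCensus.cmPlace (L : Type) ι₁)) ≃ Empty)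
  (hχ : ∀ u : stabilizer U21 x₀,
    ((lineScalar_zero V c.D hGR hGR₀ hGR₁ χ₀ (u : U21) : ℂˣ) : ℂ) *
        ((matA (stabilizerEquivK21.symm u)).det ^ (lineVacExponentsZero V c hGR₀ h₁W eR eS).eP *
          sclD (stabilizerEquivK21.symm u) ^ (lineVacExponentsZero V c hGR₀ h₁W eR eS).eQ) =
      star (sclD (stabilizerEquivK21.symm u)))
  (a : {v : InfinitePlace ↥(maximalRealSubfield L) // v.IsReal} → ℤ)
  (hω : ∀ b : {v : InfinitePlace ↥(maximalRealSubfield L) // v.IsReal}, b ≠ HypCensus.cmPlace (L : Type) ι₁ →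
    ∀ (u : UnitaryGroup.archLocal (L : Type) 3 (Matrix.diagonal (frameD V)) (cmPlaceOver (L : Type) b)) (ℓ : Module.Dual ℂ (Fin 2 → ℂ)),
      cmArchWeilRep (L : Type) e₁ (frameD V) (frameD_real V) (frameD_ne V) (lineVec (L : Type) (dW c.D 0)) (fun _ => dW_real c.D 0)
          (fun _ => dW_ne c.D 0) hGR₀
          (UnitaryGroup.archSingle (↥(maximalRealSubfield L)) L (IsCMField.complexConj L) 3 (Matrix.diagonal (frameD V))
            (IsCMField.complexConj_ne_one L) (NumberField.complexConj_smul_infinitePlace (L : Type)) (cmPlaceOver (L : Type) b) u, 1)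
          (blockFamilyOfAt (L : Type) e₁ (frameD V) (frameD_real V) (frameD_ne V) (lineVec (L : Type) (dW c.D 0)) (fun _ => dW_real c.D 0)
            (fun _ => dW_ne c.D 0) ι₁ (blockPosEquiv V) (blockNegEquiv V) eR eS (degOnePDual Empty) (binvPi 1) ℓ) =
        (((u : UnitaryGroup.archLocal (L : Type) 3 (Matrix.diagonal (frameD V)) (cmPlaceOver (L : Type) b)) : GL (Fin 3) ℂ) :
            Matrix (Fin 3) (Fin 3) ℂ).det ^ a b •
          blockFamilyOfAt (L : Type) e₁ (frameD V) (frameD_real V) (frameD_ne V) (lineVec (L : Type) (dW c.D 0)) (fun _ => dW_real c.D 0)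
            (fun _ => dW_ne c.D 0) ι₁ (blockPosEquiv V) (blockNegEquiv V) eR eS (degOnePDual Empty) (binvPi 1) ℓ)
  (hdefI : ∀ b : {v : InfinitePlace ↥(maximalRealSubfield L) // v.IsReal}, b ≠ HypCensus.cmPlace (L : Type) ι₁ →
    ∀ u : UnitaryGroup.archLocal (L : Type) 3 (Matrix.diagonal (frameD V)) (cmPlaceOver (L : Type) b),
      ((archScalar_zeroG V c.D hGR hGR₀ hGR₁ χ₀
          (UnitaryGroup.archSingle (↥(maximalRealSubfield L)) L (IsCMField.complexConj L) 3 (Matrix.diagonal (frameD V))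
            (IsCMField.complexConj_ne_one L) (NumberField.complexConj_smul_infinitePlace (L : Type)) (cmPlaceOver (L : Type) b) u) : ℂˣ) : ℂ) *
        (((u : UnitaryGroup.archLocal (L : Type) 3 (Matrix.diagonal (frameD V)) (cmPlaceOver (L : Type) b)) : GL (Fin 3) ℂ) :
            Matrix (Fin 3) (Fin 3) ℂ).det ^ a b = 1)



include hGR₂ hGR₃ χ₀ χ₂ χ₃ hι hP hχc hemb eR eS hχ a hω hdefI in
/-- **SLOT 0 OF THE JUNCTION BINDER `hJ`, PIN-GENERICALLY, FOR E's THETA MODEL** over any side family `Sf` with `Sf V c = S`, `S` reading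
`lineRepOf … χ₀ χ₁ χ₂ χ₃` at slot 0 (R2 pin: `χ₁ := etaT₁ η ν`): the slot-0 conjunct through the χ₁-TWISTED record, ONE index `j₁`, tower vector IN `block j₁`,
modulo the ONE archimedean identity (`hμ` index side in #S19's split currency ∕ `hw` automorphy side, (Hw₁′)), the pin identities, and the
side facts `hGfin` ∕ `hLF` ∕ `hη₁V` ∕ `hη₁W`. -/
theorem hJ_slot_zero_block_of_lineRepOf
    (Sf : ∀ {L : CMField} {ι₁ : L →+* ℂ} (V : HermSpace3 L ι₁) (c : SeesawCtx L), ThetaAdelicSide V c)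
    (hS : Sf V c = S)
    (hGfin : ∀ K : Subgroup ↥V.adelicFin, ThetaDistDatum.satG hV K ≤ S.Gfin) (hLF : (S.P 0).IsLFAction)
    (hη₁V : ∀ v ∈ CMRat (L : Type) (frameD V), χ₀ (v, 1) = 1)
    (hη₁W : ∀ t₀ ∈ relNormOneRat (↥(maximalRealSubfield L)) L, χ₀ (1, (cmAdelicOneEquivRelNormOne (L : Type)).symm t₀) = 1)
    (hc₁ : Continuous fun v => ((adelicCharZeroG V c hGR hGR₀ hGR₁ χ₀ v : ℂˣ) : ℂ))
    (hμ : μ (LiuIndex.GramClass.mk (aZeroJ c)) =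
      Literature.NumberTheory.Automorphic.charArchType (L : Type) (LiuIndex.centerCharInf V (adelicCharZeroG V c hGR hGR₀ hGR₁ χ₀))
          (LiuIndex.continuous_centerCharInf V _ hc₁) +
        LiuIndex.centralTypeOf V (aZeroJ c) hGR₀)
    (hw : ∀ t : ↥(Literature.NumberTheory.Automorphic.relNormOneInfUnits (↥(maximalRealSubfield L)) L),
      (S.P 0).w t *
          ((adelicCharZeroG V c hGR hGR₀ hGR₁ χ₀ (CMCenter (L : Type) (frameD V)
            ((cmAdelicOneEquivRelNormOne (L : Type)).symm (Literature.NumberTheory.Automorphic.relNormOneInfToIdeles (↥(maximalRealSubfield L)) L t))) : ℂˣ) : ℂ) =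
        ((torusScalar_zeroG V c.D hGR hGR₀ hGR₁ χ₀
            ((cmAdelicOneEquivRelNormOne (L : Type)).symm (Literature.NumberTheory.Automorphic.relNormOneInfToIdeles (↥(maximalRealSubfield L)) L t)) : ℂˣ) : ℂ)) :
    ∃ j : LiuIndex.I V (LiuIndex.repAt (aZeroJ c)) μ,
      (∃ z : (L : Type), z ≠ 0 ∧
        (LiuIndex.line V (LiuIndex.repAt (aZeroJ c)) μ j).scalar = z * conjRingHomK L z * c.D.a 0) ∧
      ∀ (Γ : Level V) (hΓ : Γ.BelowConjThree),
        ∀ ω ∈ thetaOf _ (thetaClassInputOf _ (fun V c => thetaSpaceInputOf hHD hI h₁ h₃ Sf V c)) V c 0 Γ,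
          ∃ cf : towerLevel hHD hI (ballQuotientUniformisedDatum_of h₁) h₃ hA Γ hΓ,
            TowerLevel.res hHD hI (ballQuotientUniformisedDatum_of h₁) h₃ hA cf = ω ∧
              (ofLevel hHD hI (ballQuotientUniformisedDatum_of h₁) h₃ hA Γ hΓ cf :
                  (liuDictionaryPin hHD hI h₁ h₃ hA V (LiuIndex.I V (LiuIndex.repAt (aZeroJ c)) μ)
                    (LiuIndex.line V (LiuIndex.repAt (aZeroJ c)) μ)).H) ∈
                (liuDictionaryPin hHD hI h₁ h₃ hA V (LiuIndex.I V (LiuIndex.repAt (aZeroJ c)) μ)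
                  (LiuIndex.line V (LiuIndex.repAt (aZeroJ c)) μ)).block j := by
  -- theta-3 #S19: THE index of the twisted slot record, ONCE
  obtain ⟨j, hj1, hline⟩ : ∃ j : LiuIndex.I V (LiuIndex.repAt (aZeroJ c)) μ, j.1 = LiuIndex.GramClass.mk (aZeroJ c) ∧
      LiuIndex.line V (LiuIndex.repAt (aZeroJ c)) μ j = splitLineZeroTwistedG V c hGR hGR₀ hGR₁ χ₀ hη₁V := by
    rw [splitLineZeroTwistedG_eq_ofCMOf_twistBy]
    exact LiuIndex.I.exists_line_eq_twistBy_bigCharOfV_of_eq V μ (LiuIndex.repAt_mk_self (aZeroJ c)) hGR₀ _ _ hc₁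
      (bigCharZeroG_isRatTrivial V c hGR hGR₀ hGR₁ χ₀ hη₁V) hμ
  refine ⟨j, exists_isometric_of_line_eq V _ _ hline (splitLineZeroTwistedG_scalar V c hGR hGR₀ hGR₁ χ₀ hη₁V), fun Γ hΓ θ hθ => ?_⟩
  -- sinst-1 #1238: the (J4) lift of the theta class (over the family `Sf`), moved to `S`
  obtain ⟨cl, hclω, -, F, hFsat₀, hpull₀, -⟩ := exists_fixed_adelic_lift_of_mem_thetaOf hHD hI h₁ h₃ Sf V c 0 Γ hV hθ
  have hFsat : (F : (V.latticeModel printFact_unitaryCompact_holds).G → (Fin 2 → ℂ)) ∈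
      adelicThetaSpanSat (S.P 0) S.ιinf (stabilizer U21 x₀).subtype
        (BallForms.isPullbackCocycle_cotangentCocycle.weightOf x₀) (ThetaDistDatum.satG hV Γ.K) (S.P 0).weightFunctions := by
    rw [← hS]; exact hFsat₀
  have hpull : (((pinD hHD hI h₁ h₃ Γ hV).pull cl : weightForms _ _ _) : U21 → Fin 2 → ℂ) =
      (F : (V.latticeModel printFact_unitaryCompact_holds).G → (Fin 2 → ℂ)) ∘ ⇑S.ιinf := by
    rw [← hS]; exact hpull₀
  have h𝓕 : ∀ f ∈ (S.P 0).weightFunctions,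
      ∃ χ : PontryaginDual (↥(relNormOneIdeles (↥(maximalRealSubfield L)) L) ⧸ relNormOneRat (↥(maximalRealSubfield L)) L),
        f = charInv χ := fun f ⟨χ, _, hf⟩ => ⟨χ, hf⟩
  -- binder-1 #R130 at #R129's pin-generic datum
  obtain ⟨hF', hx⟩ := clsU_mem_iSup_block_of_mem_adelicThetaSpanSat_pinZeroG hHD hI h₁ h₃ hA V c S hGR hGR₀ hGR₁ hGR₂ hGR₃
    χ₀ χ₁ χ₂ χ₃ hι h₁W hV hemb hP hχc eR eS hχ a hω hdefI h𝓕 hGfin hLF Γ.K hFsat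
  have hhol : IsHolGerm S.ιinf (F : (V.latticeModel printFact_unitaryCompact_holds).G → (Fin 2 → ℂ)) := by
    obtain ⟨i, hi⟩ := (S.mem_holSatU_iff hV 0).1 hF'
    exact ((S.mem_holSat_iff hV 0 i.1).1 hi).2
  -- binder-1 #1242∕#1243: tower vector and restriction
  refine ⟨⟨_, S.towerFamily_mem hHD hI h₁ h₃ hA hι hV hΓ hFsat hhol⟩, ?_, ?_⟩
  · rw [← hclω]
    exact S.res_towerFamily hHD hI h₁ h₃ hA hV hΓ hFsat hhol _ cl hpull
  have hFΓ : (F : (V.latticeModel printFact_unitaryCompact_holds).G → (Fin 2 → ℂ)) ∈ S.holSat hV 0 Γ (S.P 0).weightFunctions :=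
    (S.mem_holSat_iff hV 0 Γ).2 ⟨hFsat, hhol⟩
  have hU := S.clsU_eq_clsAt hHD hI h₁ h₃ hA hι hV 0 ⟨(F : _ → _), hF'⟩ ⟨Γ, hΓ⟩ hFΓ
  rw [clsAt_apply] at hU
  rw [← hU]
  -- binder-2 #104 over sinst-1 #1266∕#1267 and the (Hw₁′) identity
  exact mem_block_pin_of_line_eq_of_mem_biSup hHD hI h₁ h₃ hA V _ _
    (fun χ => ((pinDatumZeroG V c S hGR hGR₀ hGR₁ hGR₂ hGR₃ χ₀ χ₁ χ₂ χ₃ hι h₁W hV hemb hP hχc eR eS hχ a hω hdefI).coinvRep χ).asModule)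
    hline (fun χ => charZeroDictG V c hGR hGR₀ hGR₁ χ₀ χ)
    (fun χ hχ𝓕 => isAutChar_charZeroDictG_of_weight V c hGR hGR₀ hGR₁ χ₀ hχc hη₁V hη₁W h₁W χ _
      (WeilPairData.forall_weight_of_charInv_mem_weightFunctions _ hχ𝓕) hw)
    (fun χ _ => (dictEquivZeroCanonicalG V c S hGR hGR₀ hGR₁ hGR₂ hGR₃ χ₀ χ₁ χ₂ χ₃ hι h₁W hV hP hχc hη₁V _ _ _ χ).toLinearMap)
    (fun χ _ => LinearEquiv.surjective _) hx

end Zero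

/-! ## Slot 1 -/

section One

variable (hP : (S.P 1).ω = lineRepOf V c.D hGR hGR₀ hGR₁ hGR₂ hGR₃ χ₀ χ₁ χ₂ χ₃ 1)
  (hχc : Continuous fun p => ((χ₁ p : ℂˣ) : ℂ))
  (eR : PosIdx (cmXW (L : Type) (frameD V) (lineVec (L : Type) (dW c.D 1)) (fun _ => dW_real c.D 1) ι₁ (HypCensus.cmPlace (L : Type) ι₁)) ≃ Unit)
  (eS : NegIdx (cmXW (L : Type) (frameD V) (lineVec (L : Type) (dW c.D 1)) (fun _ => dW_real c.D 1) ι₁ (HypCensus.cmPlace (L : Type) ι₁)) ≃ Empty)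
  (hχ : ∀ u : stabilizer U21 x₀,
    ((lineScalar_one V c.D hGR hGR₀ hGR₁ χ₁ (u : U21) : ℂˣ) : ℂ) *
        ((matA (stabilizerEquivK21.symm u)).det ^ (lineVacExponentsOne V c hGR₁ h₁W eR eS).eP *
          sclD (stabilizerEquivK21.symm u) ^ (lineVacExponentsOne V c hGR₁ h₁W eR eS).eQ) =
      star (sclD (stabilizerEquivK21.symm u)))
  (a : {v : InfinitePlace ↥(maximalRealSubfield L) // v.IsReal} → ℤ)
  (hω : ∀ b : {v : InfinitePlace ↥(maximalRealSubfield L) // v.IsReal}, b ≠ HypCensus.cmPlace (L : Type) ι₁ →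
    ∀ (u : UnitaryGroup.archLocal (L : Type) 3 (Matrix.diagonal (frameD V)) (cmPlaceOver (L : Type) b)) (ℓ : Module.Dual ℂ (Fin 2 → ℂ)),
      cmArchWeilRep (L : Type) e₁ (frameD V) (frameD_real V) (frameD_ne V) (lineVec (L : Type) (dW c.D 1)) (fun _ => dW_real c.D 1)
          (fun _ => dW_ne c.D 1) hGR₁
          (UnitaryGroup.archSingle (↥(maximalRealSubfield L)) L (IsCMField.complexConj L) 3 (Matrix.diagonal (frameD V))
            (IsCMField.complexConj_ne_one L) (NumberField.complexConj_smul_infinitePlace (L : Type)) (cmPlaceOver (L : Type) b) u, 1)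
          (blockFamilyOfAt (L : Type) e₁ (frameD V) (frameD_real V) (frameD_ne V) (lineVec (L : Type) (dW c.D 1)) (fun _ => dW_real c.D 1)
            (fun _ => dW_ne c.D 1) ι₁ (blockPosEquiv V) (blockNegEquiv V) eR eS (degOnePDual Empty) (binvPi 1) ℓ) =
        (((u : UnitaryGroup.archLocal (L : Type) 3 (Matrix.diagonal (frameD V)) (cmPlaceOver (L : Type) b)) : GL (Fin 3) ℂ) :
            Matrix (Fin 3) (Fin 3) ℂ).det ^ a b •
          blockFamilyOfAt (L : Type) e₁ (frameD V) (frameD_real V) (frameD_ne V) (lineVec (L : Type) (dW c.D 1)) (fun _ => dW_real c.D 1)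
            (fun _ => dW_ne c.D 1) ι₁ (blockPosEquiv V) (blockNegEquiv V) eR eS (degOnePDual Empty) (binvPi 1) ℓ)
  (hdefI : ∀ b : {v : InfinitePlace ↥(maximalRealSubfield L) // v.IsReal}, b ≠ HypCensus.cmPlace (L : Type) ι₁ →
    ∀ u : UnitaryGroup.archLocal (L : Type) 3 (Matrix.diagonal (frameD V)) (cmPlaceOver (L : Type) b),
      ((archScalar_oneG V c.D hGR hGR₀ hGR₁ χ₁
          (UnitaryGroup.archSingle (↥(maximalRealSubfield L)) L (IsCMField.complexConj L) 3 (Matrix.diagonal (frameD V))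
            (IsCMField.complexConj_ne_one L) (NumberField.complexConj_smul_infinitePlace (L : Type)) (cmPlaceOver (L : Type) b) u) : ℂˣ) : ℂ) *
        (((u : UnitaryGroup.archLocal (L : Type) 3 (Matrix.diagonal (frameD V)) (cmPlaceOver (L : Type) b)) : GL (Fin 3) ℂ) :
            Matrix (Fin 3) (Fin 3) ℂ).det ^ a b = 1)



include hGR₂ hGR₃ χ₀ χ₂ χ₃ hι hP hχc hemb eR eS hχ a hω hdefI in
/-- **SLOT 1 OF THE JUNCTION BINDER `hJ`, PIN-GENERICALLY, FOR E's THETA MODEL** over any side family `Sf` with `Sf V c = S`, `S` reading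
`lineRepOf … χ₀ χ₁ χ₂ χ₃` at slot 1 (R2 pin: `χ₁ := etaT₁ η ν`): the slot-1 conjunct through the χ₁-TWISTED record, ONE index `j₁`, tower vector IN `block j₁`,
modulo the ONE archimedean identity (`hμ` index side in #S19's split currency ∕ `hw` automorphy side, (Hw₁′)), the pin identities, and the
side facts `hGfin` ∕ `hLF` ∕ `hη₁V` ∕ `hη₁W`. -/
theorem hJ_slot_one_block_of_lineRepOf
    (Sf : ∀ {L : CMField} {ι₁ : L →+* ℂ} (V : HermSpace3 L ι₁) (c : SeesawCtx L), ThetaAdelicSide V c)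
    (hS : Sf V c = S)
    (hGfin : ∀ K : Subgroup ↥V.adelicFin, ThetaDistDatum.satG hV K ≤ S.Gfin) (hLF : (S.P 1).IsLFAction)
    (hη₁V : ∀ v ∈ CMRat (L : Type) (frameD V), χ₁ (v, 1) = 1)
    (hη₁W : ∀ t₀ ∈ relNormOneRat (↥(maximalRealSubfield L)) L, χ₁ (1, (cmAdelicOneEquivRelNormOne (L : Type)).symm t₀) = 1)
    (hc₁ : Continuous fun v => ((adelicCharOne V c hGR hGR₀ hGR₁ χ₁ v : ℂˣ) : ℂ))
    (hμ : μ (LiuIndex.GramClass.mk (aOneJ c)) =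
      Literature.NumberTheory.Automorphic.charArchType (L : Type) (LiuIndex.centerCharInf V (adelicCharOne V c hGR hGR₀ hGR₁ χ₁))
          (LiuIndex.continuous_centerCharInf V _ hc₁) +
        LiuIndex.centralTypeOf V (aOneJ c) hGR₁)
    (hw : ∀ t : ↥(Literature.NumberTheory.Automorphic.relNormOneInfUnits (↥(maximalRealSubfield L)) L),
      (S.P 1).w t *
          ((adelicCharOne V c hGR hGR₀ hGR₁ χ₁ (CMCenter (L : Type) (frameD V)
            ((cmAdelicOneEquivRelNormOne (L : Type)).symm (Literature.NumberTheory.Automorphic.relNormOneInfToIdeles (↥(maximalRealSubfield L)) L t))) : ℂˣ) : ℂ) =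
        ((torusScalar_oneG V c.D hGR hGR₀ hGR₁ χ₁
            ((cmAdelicOneEquivRelNormOne (L : Type)).symm (Literature.NumberTheory.Automorphic.relNormOneInfToIdeles (↥(maximalRealSubfield L)) L t)) : ℂˣ) : ℂ)) :
    ∃ j : LiuIndex.I V (LiuIndex.repAt (aOneJ c)) μ,
      (∃ z : (L : Type), z ≠ 0 ∧
        (LiuIndex.line V (LiuIndex.repAt (aOneJ c)) μ j).scalar = z * conjRingHomK L z * c.D.a 1) ∧
      ∀ (Γ : Level V) (hΓ : Γ.BelowConjThree),
        ∀ ω ∈ thetaOf _ (thetaClassInputOf _ (fun V c => thetaSpaceInputOf hHD hI h₁ h₃ Sf V c)) V c 1 Γ,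
          ∃ cf : towerLevel hHD hI (ballQuotientUniformisedDatum_of h₁) h₃ hA Γ hΓ,
            TowerLevel.res hHD hI (ballQuotientUniformisedDatum_of h₁) h₃ hA cf = ω ∧
              (ofLevel hHD hI (ballQuotientUniformisedDatum_of h₁) h₃ hA Γ hΓ cf :
                  (liuDictionaryPin hHD hI h₁ h₃ hA V (LiuIndex.I V (LiuIndex.repAt (aOneJ c)) μ)
                    (LiuIndex.line V (LiuIndex.repAt (aOneJ c)) μ)).H) ∈
                (liuDictionaryPin hHD hI h₁ h₃ hA V (LiuIndex.I V (LiuIndex.repAt (aOneJ c)) μ)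
                  (LiuIndex.line V (LiuIndex.repAt (aOneJ c)) μ)).block j := by
  -- theta-3 #S19: THE index of the twisted slot record, ONCE
  obtain ⟨j, hj1, hline⟩ : ∃ j : LiuIndex.I V (LiuIndex.repAt (aOneJ c)) μ, j.1 = LiuIndex.GramClass.mk (aOneJ c) ∧
      LiuIndex.line V (LiuIndex.repAt (aOneJ c)) μ j = splitLineOneTwistedG V c hGR hGR₀ hGR₁ χ₁ hη₁V := by
    rw [splitLineOneTwistedG_eq_ofCMOf_twistBy]
    exact LiuIndex.I.exists_line_eq_twistBy_bigCharOfV_of_eq V μ (LiuIndex.repAt_mk_self (aOneJ c)) hGR₁ _ _ hc₁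
      (bigCharOne_isRatTrivial V c hGR hGR₀ hGR₁ χ₁ hη₁V) hμ
  refine ⟨j, exists_isometric_of_line_eq V _ _ hline (splitLineOneTwistedG_scalar V c hGR hGR₀ hGR₁ χ₁ hη₁V), fun Γ hΓ θ hθ => ?_⟩
  -- sinst-1 #1238: the (J4) lift of the theta class (over the family `Sf`), moved to `S`
  obtain ⟨cl, hclω, -, F, hFsat₀, hpull₀, -⟩ := exists_fixed_adelic_lift_of_mem_thetaOf hHD hI h₁ h₃ Sf V c 1 Γ hV hθ
  have hFsat : (F : (V.latticeModel printFact_unitaryCompact_holds).G → (Fin 2 → ℂ)) ∈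
      adelicThetaSpanSat (S.P 1) S.ιinf (stabilizer U21 x₀).subtype
        (BallForms.isPullbackCocycle_cotangentCocycle.weightOf x₀) (ThetaDistDatum.satG hV Γ.K) (S.P 1).weightFunctions := by
    rw [← hS]; exact hFsat₀
  have hpull : (((pinD hHD hI h₁ h₃ Γ hV).pull cl : weightForms _ _ _) : U21 → Fin 2 → ℂ) =
      (F : (V.latticeModel printFact_unitaryCompact_holds).G → (Fin 2 → ℂ)) ∘ ⇑S.ιinf := by
    rw [← hS]; exact hpull₀
  have h𝓕 : ∀ f ∈ (S.P 1).weightFunctions,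
      ∃ χ : PontryaginDual (↥(relNormOneIdeles (↥(maximalRealSubfield L)) L) ⧸ relNormOneRat (↥(maximalRealSubfield L)) L),
        f = charInv χ := fun f ⟨χ, _, hf⟩ => ⟨χ, hf⟩
  -- binder-1 #R130 at #R129's pin-generic datum
  obtain ⟨hF', hx⟩ := clsU_mem_iSup_block_of_mem_adelicThetaSpanSat_pinOneG hHD hI h₁ h₃ hA V c S hGR hGR₀ hGR₁ hGR₂ hGR₃
    χ₀ χ₁ χ₂ χ₃ hι h₁W hV hemb hP hχc eR eS hχ a hω hdefI h𝓕 hGfin hLF Γ.K hFsat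
  have hhol : IsHolGerm S.ιinf (F : (V.latticeModel printFact_unitaryCompact_holds).G → (Fin 2 → ℂ)) := by
    obtain ⟨i, hi⟩ := (S.mem_holSatU_iff hV 1).1 hF'
    exact ((S.mem_holSat_iff hV 1 i.1).1 hi).2
  -- binder-1 #1242∕#1243: tower vector and restriction
  refine ⟨⟨_, S.towerFamily_mem hHD hI h₁ h₃ hA hι hV hΓ hFsat hhol⟩, ?_, ?_⟩
  · rw [← hclω]
    exact S.res_towerFamily hHD hI h₁ h₃ hA hV hΓ hFsat hhol _ cl hpull
  have hFΓ : (F : (V.latticeModel printFact_unitaryCompact_holds).G → (Fin 2 → ℂ)) ∈ S.holSat hV 1 Γ (S.P 1).weightFunctions :=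
    (S.mem_holSat_iff hV 1 Γ).2 ⟨hFsat, hhol⟩
  have hU := S.clsU_eq_clsAt hHD hI h₁ h₃ hA hι hV 1 ⟨(F : _ → _), hF'⟩ ⟨Γ, hΓ⟩ hFΓ
  rw [clsAt_apply] at hU
  rw [← hU]
  -- binder-2 #104 over sinst-1 #1264∕#1265 and the (Hw₁′) identity
  exact mem_block_pin_of_line_eq_of_mem_biSup hHD hI h₁ h₃ hA V _ _
    (fun χ => ((pinDatumOneG V c S hGR hGR₀ hGR₁ hGR₂ hGR₃ χ₀ χ₁ χ₂ χ₃ hι h₁W hV hemb hP hχc eR eS hχ a hω hdefI).coinvRep χ).asModule)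
    hline (fun χ => charOneDictG V c hGR hGR₀ hGR₁ χ₁ χ)
    (fun χ hχ𝓕 => isAutChar_charOneDictG_of_weight V c hGR hGR₀ hGR₁ χ₁ hχc hη₁V hη₁W h₁W χ _
      (WeilPairData.forall_weight_of_charInv_mem_weightFunctions _ hχ𝓕) hw)
    (fun χ _ => (dictEquivOneCanonicalG V c S hGR hGR₀ hGR₁ hGR₂ hGR₃ χ₀ χ₁ χ₂ χ₃ hι hV hP hχc hη₁V _ _ _ χ).toLinearMap)
    (fun χ _ => LinearEquiv.surjective _) hx

end One

end ThetaAdelicSide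
end HodgeCM.Model

end
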